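import Summits.ValiantsHypothesis.ValiantsHypothesis.Theses.DivisionGap
import Literature.Barriers.ValiantsHypothesis.MonotoneGapParseTrees
import Literature.Barriers.ValiantsHypothesis.MonotoneGapProofs
import Literature.Barriers.ValiantsHypothesis.MonotoneGapUpper
import Literature.Computability.AlgebraicComplexity.ArithCircuitProofs
import Literature.Computability.AlgebraicComplexity.ValiantClassesProofs

/-!
# `ZeroOneTransfer` — negative-side infrastructure: initial forms are free for monotone circuits

Crux `stmt-ValiantsHypothesis-5066` (`Theses.DivisionGap.ZeroOneTransfer`, route DivisionGap).
Standing disprover (cdisprove), `Cruxes/ZeroOneTransfer/Disproof.lean` §(B2).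

For a weight `w : σ → ℕ` on the variables and `p ∈ ℝ≥0[σ]`, `topComponent w p` is the sum of the
terms of `p` of maximal `w`-weight (the initial form of `p` in direction `-w`).  Over the
semiring `ℝ≥0` there is no cancellation, so in a fan-in-two circuit every gate can be PRUNED to
compute the top component of its value: a sum gate keeps the operands of maximal weight, a
product gate is unchanged (`topComponent_mul`).  Hence

* `complexity_topComponent_le` — `L_{ℝ≥0}(top_w p) ≤ L_{ℝ≥0}(p)`: passing to an initial form costs
  nothing in the tree's monotone model.

This is the degeneration step of every division-robust monotone argument (`f·h = g` ⇒
`f · top_w h = top_w g` when `f` is `w`-homogeneous); it is used in `LowDegreeCofactor.lean` to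
show that cofactors of degree `δ` buy at most `δ` rows of the spanning-tree polynomial.
[folklore]
-/

namespace Summit.ValiantsHypothesis.ValiantsHypothesis.Theorems.ZeroOneTransfer.Negative

open Literature.Computability.AlgebraicComplexity Literature.Barriers.ValiantsHypothesis
open MvPolynomial Finset
open ArithCircuit (Gate Operand gateValues)
open scoped NNReal

noncomputable section

variable {σ : Type*}

/-! ### The top weighted component over `ℝ≥0` -/

/-- The top `w`-component of `p`: its terms of maximal `w`-weight (initial form in direction
`-w`). [folklore] -/
def topComponent (w : σ → ℕ) (p : MvPolynomial σ ℝ≥0) : MvPolynomial σ ℝ≥0 :=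
  weightedHomogeneousComponent w (weightedTotalDegree w p) p

variable (w : σ → ℕ)

/-- Coefficients of the top component. [folklore] -/
theorem coeff_topComponent (p : MvPolynomial σ ℝ≥0) (d : σ →₀ ℕ) :
    coeff d (topComponent w p) =
      if Finsupp.weight w d = weightedTotalDegree w p then coeff d p else 0 := by
  classical
  unfold topComponent
  convert coeff_weightedHomogeneousComponent (w := w) (weightedTotalDegree w p) p d

/-- `top 0 = 0`. [folklore] -/
@[simp] theorem topComponent_zero : topComponent w (0 : MvPolynomial σ ℝ≥0) = 0 := by
  simp [topComponent]

/-- A weighted-homogeneous polynomial is its own top component. [folklore] -/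
theorem topComponent_eq_self_of_isWeightedHomogeneous {p : MvPolynomial σ ℝ≥0} {n : ℕ}
    (hp : IsWeightedHomogeneous w p n) : topComponent w p = p := by
  by_cases h0 : p = 0
  · simp [h0]
  have h1 := hp.weighted_total_degree h0
  rw [weightedTotalDegree_coe w p h0] at h1
  have h2 : weightedTotalDegree w p = n := WithBot.coe_injective h1
  unfold topComponent
  rw [h2]
  exact hp.weightedHomogeneousComponent_same

/-- `top (X i) = X i`. [folklore] -/
@[simp] theorem topComponent_X (i : σ) : topComponent w (X i : MvPolynomial σ ℝ≥0) = X i :=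
  topComponent_eq_self_of_isWeightedHomogeneous w (isWeightedHomogeneous_X ℝ≥0 w i)

/-- `top (C c) = C c`. [folklore] -/
@[simp] theorem topComponent_C (c : ℝ≥0) : topComponent w (C c : MvPolynomial σ ℝ≥0) = C c :=
  topComponent_eq_self_of_isWeightedHomogeneous w (isWeightedHomogeneous_C w c)

/-- A nonzero polynomial has a nonzero top component. [folklore] -/
theorem topComponent_ne_zero {p : MvPolynomial σ ℝ≥0} (hp : p ≠ 0) : topComponent w p ≠ 0 := by
  classical
  have hne : p.support.Nonempty := support_nonempty.mpr hp
  obtain ⟨d, hd, hsup⟩ := Finset.exists_mem_eq_sup p.support hne (Finsupp.weight w)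
  intro h
  have := congrArg (coeff d) h
  rw [coeff_topComponent, coeff_zero, if_pos] at this
  · exact (mem_support_iff.mp hd) this
  · rw [weightedTotalDegree, hsup]

/-- The top component is a sub-sum: its support lies in that of `p`. [folklore] -/
theorem support_topComponent_subset (p : MvPolynomial σ ℝ≥0) :
    (topComponent w p).support ⊆ p.support := by
  intro d hd
  rw [mem_support_iff, coeff_topComponent] at hd
  split_ifs at hd with h
  · exact mem_support_iff.mpr hd
  · exact absurd rfl hd

/-- Over `ℝ≥0`: the weighted degree of a product of nonzero polynomials is additive. [folklore] -/
theorem weightedTotalDegree_mul {p q : MvPolynomial σ ℝ≥0} (hp : p ≠ 0) (hq : q ≠ 0) :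
    weightedTotalDegree w (p * q) = weightedTotalDegree w p + weightedTotalDegree w q := by
  classical
  apply le_antisymm
  · refine Finset.sup_le fun d hd => ?_
    obtain ⟨a, ha, b, hb, rfl⟩ := Finset.mem_add.1 (support_mul p q hd)
    rw [map_add]
    exact add_le_add (le_weightedTotalDegree w ha) (le_weightedTotalDegree w hb)
  · obtain ⟨a, ha, hsa⟩ := Finset.exists_mem_eq_sup p.support (support_nonempty.mpr hp)
      (Finsupp.weight w)
    obtain ⟨b, hb, hsb⟩ := Finset.exists_mem_eq_sup q.support (support_nonempty.mpr hq)
      (Finsupp.weight w)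
    have hab : a + b ∈ (p * q).support := by
      rw [JerrumSnir.support_mul_eq]
      exact Finset.add_mem_add ha hb
    calc weightedTotalDegree w p + weightedTotalDegree w q
        = Finsupp.weight w a + Finsupp.weight w b := by rw [weightedTotalDegree, hsa,
            weightedTotalDegree, hsb]
      _ = Finsupp.weight w (a + b) := by rw [map_add]
      _ ≤ weightedTotalDegree w (p * q) := le_weightedTotalDegree w hab

/-- **Top components are multiplicative over `ℝ≥0`.** [folklore] -/
theorem topComponent_mul (p q : MvPolynomial σ ℝ≥0) :
    topComponent w (p * q) = topComponent w p * topComponent w q := by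
  classical
  by_cases hp : p = 0
  · simp [hp]
  by_cases hq : q = 0
  · simp [hq]
  have hD := weightedTotalDegree_mul w hp hq
  refine MvPolynomial.ext _ _ fun d => ?_
  rw [coeff_topComponent, coeff_mul, coeff_mul, hD]
  split_ifs with hwd
  · refine Finset.sum_congr rfl fun x hx => ?_
    rw [coeff_topComponent, coeff_topComponent]
    have hxd : x.1 + x.2 = d := Finset.HasAntidiagonal.mem_antidiagonal.mp hx
    by_cases hpa : coeff x.1 p = 0
    · simp [hpa]
    by_cases hqb : coeff x.2 q = 0
    · simp [hqb]
    have ha : Finsupp.weight w x.1 ≤ weightedTotalDegree w p :=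
      le_weightedTotalDegree w (mem_support_iff.mpr hpa)
    have hb : Finsupp.weight w x.2 ≤ weightedTotalDegree w q :=
      le_weightedTotalDegree w (mem_support_iff.mpr hqb)
    have hsum : Finsupp.weight w x.1 + Finsupp.weight w x.2 =
        weightedTotalDegree w p + weightedTotalDegree w q := by
      rw [← map_add, hxd, hwd]
    rw [if_pos (by omega), if_pos (by omega)]
  · symm
    refine Finset.sum_eq_zero fun x hx => ?_
    rw [coeff_topComponent, coeff_topComponent]
    have hxd : x.1 + x.2 = d := Finset.HasAntidiagonal.mem_antidiagonal.mp hx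
    split_ifs with h1 h2
    · exfalso; apply hwd
      rw [← hxd, map_add, h1, h2]
    · simp
    · simp
    · simp

/-- Over `ℝ≥0` a list sum of scalar multiples has the union of the supports of its effective
summands, so each effective summand has weighted degree at most that of the sum. [folklore] -/
theorem weightedTotalDegree_le_of_mem (L : List (ℝ≥0 × MvPolynomial σ ℝ≥0))
    {a : ℝ≥0 × MvPolynomial σ ℝ≥0} (ha : a ∈ L) (ha1 : a.1 ≠ 0) :
    weightedTotalDegree w a.2 ≤ weightedTotalDegree w (L.map fun b => b.1 • b.2).sum := by
  classical
  refine Finset.sup_le fun d hd => le_weightedTotalDegree w ?_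
  rw [JerrumSnir.mem_support_list_sum]
  refine ⟨a.1 • a.2, List.mem_map.mpr ⟨a, ha, rfl⟩, ?_⟩
  rwa [JerrumSnir.support_smul_eq ha1]

/-- Coefficients of a list sum. [folklore] -/
theorem coeff_list_sum' (d : σ →₀ ℕ) (L : List (MvPolynomial σ ℝ≥0)) :
    coeff d L.sum = (L.map (coeff d)).sum := by
  induction L with
  | nil => simp
  | cons p L ih => simp [List.sum_cons, coeff_add, ih]

/-- Sum over a filtered list as a sum with indicators. [folklore] -/
theorem list_sum_map_filter {α β : Type*} [AddCommMonoid β] (L : List α) (P : α → Bool)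
    (f : α → β) :
    ((L.filter P).map f).sum = (L.map fun a => if P a then f a else 0).sum := by
  induction L with
  | nil => simp
  | cons a L ih =>
    rw [List.filter_cons]
    by_cases h : P a = true
    · simp [h, ih]
    · simp [h, ih]

/-- **Top component of a weighted sum over `ℝ≥0`**: keep exactly the effective summands whose
weighted degree is that of the whole sum. [folklore] -/
theorem topComponent_list_sum [DecidableEq σ] (L : List (ℝ≥0 × MvPolynomial σ ℝ≥0)) :
    topComponent w (L.map fun b => b.1 • b.2).sum =
      ((L.filter fun b => decide (b.1 ≠ 0 ∧ b.2 ≠ 0 ∧ weightedTotalDegree w b.2 =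
          weightedTotalDegree w (L.map fun b => b.1 • b.2).sum)).map
        fun b => b.1 • topComponent w b.2).sum := by
  classical
  set S := (L.map fun b => b.1 • b.2).sum with hS
  have key : ∀ b ∈ L, ∀ d : σ →₀ ℕ,
      (if (b.1 ≠ 0 ∧ b.2 ≠ 0 ∧ weightedTotalDegree w b.2 = weightedTotalDegree w S) then
          b.1 * coeff d (topComponent w b.2) else 0) =
        if Finsupp.weight w d = weightedTotalDegree w S then b.1 * coeff d b.2 else 0 := by
    intro b hb d
    rw [coeff_topComponent]
    by_cases h1 : b.1 = 0
    · simp [h1]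
    by_cases h2 : b.2 = 0
    · simp [h2]
    by_cases h3 : weightedTotalDegree w b.2 = weightedTotalDegree w S
    · simp [h1, h2, h3]
    · rw [if_neg (by simp [h3])]
      split_ifs with h4
      · -- `deg b.2 < deg S = weight d`, so `d ∉ supp b.2`
        have hle : weightedTotalDegree w b.2 ≤ weightedTotalDegree w S :=
          hS ▸ weightedTotalDegree_le_of_mem w L hb h1
        have hlt : weightedTotalDegree w b.2 < Finsupp.weight w d :=
          lt_of_le_of_ne (h4 ▸ hle) (h4 ▸ h3)
        have : coeff d b.2 = 0 := by
          by_contra hne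
          exact absurd (le_weightedTotalDegree w (mem_support_iff.mpr hne)) (not_le.mpr hlt)
        rw [this, mul_zero]
      · rfl
  refine MvPolynomial.ext _ _ fun d => ?_
  rw [coeff_topComponent, list_sum_map_filter, coeff_list_sum', coeff_list_sum', List.map_map,
    List.map_map]
  have hR : (L.map (coeff d ∘ fun a => if decide (a.1 ≠ 0 ∧ a.2 ≠ 0 ∧
      weightedTotalDegree w a.2 = weightedTotalDegree w S) then a.1 • topComponent w a.2
      else 0)) = L.map fun b =>
        if Finsupp.weight w d = weightedTotalDegree w S then b.1 * coeff d b.2 else 0 := by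
    refine List.map_congr_left fun b hb => ?_
    rw [← key b hb d]
    simp only [Function.comp_apply, decide_eq_true_eq]
    split_ifs <;> simp [coeff_smul]
  rw [hR]
  by_cases hwd : Finsupp.weight w d = weightedTotalDegree w S
  · simp only [hwd, if_true]
    exact congrArg List.sum (List.map_congr_left fun b _ => by
      simp only [Function.comp_apply, coeff_smul, smul_eq_mul])
  · simp only [hwd, if_false]
    symm
    exact List.sum_eq_zero (fun x hx => by
      obtain ⟨b, -, rfl⟩ := List.mem_map.mp hx; rfl)


/-- `top 1 = 1`. [folklore] -/
@[simp] theorem topComponent_one : topComponent w (1 : MvPolynomial σ ℝ≥0) = 1 := by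
  rw [← C_1]; exact topComponent_C w 1

/-- Top components of list products. [folklore] -/
theorem topComponent_list_prod (l : List (MvPolynomial σ ℝ≥0)) :
    topComponent w l.prod = (l.map (topComponent w)).prod := by
  induction l with
  | nil => simp
  | cons p l ih => rw [List.prod_cons, topComponent_mul, ih, List.map_cons, List.prod_cons]

/-! ### Pruning a fan-in-two circuit over `ℝ≥0` to the top component -/

open Classical in
/-- Prune one gate against the ORIGINAL values `vals` of the earlier gates: a sum gate keeps its
effective operands whose value has the top weighted degree of the gate's value; a product gate
is unchanged. [folklore] -/
def pruneGate (vals : List (MvPolynomial σ ℝ≥0)) : Gate ℝ≥0 σ → Gate ℝ≥0 σ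
  | .sum args => .sum (args.filter fun a => decide (a.1 ≠ 0 ∧ a.2.eval vals ≠ 0 ∧
      weightedTotalDegree w (a.2.eval vals) =
        weightedTotalDegree w ((args.map fun b => b.1 • b.2.eval vals).sum)))
  | .prod args => .prod args

/-- Prune a gate list, threading the original gate values (a left fold, like `gateValues`).
[folklore] -/
def pruneAux (gs : List (Gate ℝ≥0 σ)) : List (Gate ℝ≥0 σ) × List (MvPolynomial σ ℝ≥0) :=
  gs.foldl (fun acc g => (acc.1 ++ [pruneGate w acc.2 g], acc.2 ++ [g.eval acc.2])) ([], [])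

/-- One step of the fold. [folklore] -/
theorem pruneAux_append_singleton (gs : List (Gate ℝ≥0 σ)) (g : Gate ℝ≥0 σ) :
    pruneAux w (gs ++ [g]) =
      ((pruneAux w gs).1 ++ [pruneGate w (pruneAux w gs).2 g],
        (pruneAux w gs).2 ++ [g.eval (pruneAux w gs).2]) := by
  simp [pruneAux, List.foldl_append]

/-- The threaded values are the original gate values. [folklore] -/
theorem pruneAux_snd (gs : List (Gate ℝ≥0 σ)) : (pruneAux w gs).2 = gateValues gs := by
  induction gs using List.reverseRecOn with
  | nil => rfl
  | append_singleton gs g ih =>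
    rw [pruneAux_append_singleton, ArithCircuit.gateValues_append_singleton, ih]

/-- Pruning keeps the number of gates. [folklore] -/
theorem pruneAux_length (gs : List (Gate ℝ≥0 σ)) : (pruneAux w gs).1.length = gs.length := by
  induction gs using List.reverseRecOn with
  | nil => rfl
  | append_singleton gs g ih => simp [pruneAux_append_singleton, ih]

/-- Every pruned gate is the pruning of an original gate. [folklore] -/
theorem mem_pruneAux {gs : List (Gate ℝ≥0 σ)} {g : Gate ℝ≥0 σ} (hg : g ∈ (pruneAux w gs).1) :
    ∃ vals g₀, g₀ ∈ gs ∧ g = pruneGate w vals g₀ := by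
  induction gs using List.reverseRecOn with
  | nil => simp [pruneAux] at hg
  | append_singleton gs g' ih =>
    rw [pruneAux_append_singleton] at hg
    simp only [List.mem_append, List.mem_singleton] at hg
    rcases hg with hg | rfl
    · obtain ⟨vals, g₀, h₀, rfl⟩ := ih hg
      exact ⟨vals, g₀, List.mem_append_left _ h₀, rfl⟩
    · exact ⟨_, g', by simp, rfl⟩

/-- Pruning does not increase the fan-in. [folklore] -/
theorem fanIn_pruneGate_le (vals : List (MvPolynomial σ ℝ≥0)) (g : Gate ℝ≥0 σ) :
    (pruneGate w vals g).fanIn ≤ g.fanIn := by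
  cases g with
  | sum args =>
    simp only [pruneGate, Gate.fanIn, ArithCircuit.Gate.args, List.length_map]
    exact List.length_filter_le _ _
  | prod args => simp [pruneGate]

/-- Operands read top components off the list of top components. [folklore] -/
theorem operand_eval_map_topComponent (vals : List (MvPolynomial σ ℝ≥0)) (u : Operand ℝ≥0 σ) :
    u.eval (vals.map (topComponent w)) = topComponent w (u.eval vals) := by
  cases u with
  | var i => simp [Operand.eval]
  | const c => simp [Operand.eval]
  | gate j =>
    simp only [ArithCircuit.Operand.eval_gate, List.getD_eq_getElem?_getD, List.getElem?_map]
    cases vals[j]? with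
    | none => simp
    | some v => simp

/-- **The pruned gate computes the top component of the original gate's value** (over `ℝ≥0`:
`topComponent_list_sum` for sum gates, `topComponent_mul` for product gates). [folklore] -/
theorem pruneGate_eval [DecidableEq σ] (vals : List (MvPolynomial σ ℝ≥0)) (g : Gate ℝ≥0 σ) :
    (pruneGate w vals g).eval (vals.map (topComponent w)) = topComponent w (g.eval vals) := by
  classical
  cases g with
  | sum args =>
    simp only [pruneGate, Gate.eval]
    have hS : ((args.map fun a => (a.1, a.2.eval vals)).map fun b => b.1 • b.2) =
        args.map fun b => b.1 • b.2.eval vals := by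
      rw [List.map_map]; rfl
    rw [← hS, topComponent_list_sum]
    simp only [List.filter_map, List.map_map, list_sum_map_filter, Function.comp_def,
      operand_eval_map_topComponent]
  | prod args =>
    simp only [pruneGate, Gate.eval]
    rw [topComponent_list_prod, List.map_map]
    congr 1
    refine List.map_congr_left fun u _ => ?_
    simp only [Function.comp_apply, operand_eval_map_topComponent]

/-- The pruned circuit: pruned gates, same output operand. [folklore] -/
def prune (P : ArithCircuit ℝ≥0 σ) : ArithCircuit ℝ≥0 σ where
  gates := (pruneAux w P.gates).1
  output := P.output

/-- **The values of the pruned gates are the top components of the original values.**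
[folklore] -/
theorem gateValues_pruneAux [DecidableEq σ] (gs : List (Gate ℝ≥0 σ)) :
    gateValues (pruneAux w gs).1 = (gateValues gs).map (topComponent w) := by
  induction gs using List.reverseRecOn with
  | nil => rfl
  | append_singleton gs g ih =>
    rw [pruneAux_append_singleton, ArithCircuit.gateValues_append_singleton,
      ArithCircuit.gateValues_append_singleton, ih, pruneAux_snd, List.map_append,
      List.map_singleton, pruneGate_eval]

/-- The pruned circuit computes the top component. [folklore] -/
theorem eval_prune [DecidableEq σ] (P : ArithCircuit ℝ≥0 σ) :
    (prune w P).eval = topComponent w P.eval := by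
  simp only [ArithCircuit.eval, prune]
  rw [gateValues_pruneAux, operand_eval_map_topComponent]

/-- Pruning keeps the size. [folklore] -/
theorem size_prune (P : ArithCircuit ℝ≥0 σ) : (prune w P).size = P.size :=
  pruneAux_length w P.gates

/-- Pruning keeps fan-in two. [folklore] -/
theorem isFanInTwo_prune {P : ArithCircuit ℝ≥0 σ} (h : P.IsFanInTwo) :
    (prune w P).IsFanInTwo := by
  intro g hg
  obtain ⟨vals, g₀, h₀, rfl⟩ := mem_pruneAux w hg
  exact (fanIn_pruneGate_le w vals g₀).trans (h g₀ h₀)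

/-- **Initial forms are free for monotone circuits over `ℝ≥0`**: `L(top_w p) ≤ L(p)` in the
tree's fan-in-two `complexity` over the semiring `ℝ≥0`, for every weight `w : σ → ℕ`.
[folklore] -/
theorem complexity_topComponent_le (p : MvPolynomial σ ℝ≥0) :
    complexity (topComponent w p) ≤ complexity p := by
  classical
  obtain ⟨P, h2, hP, hsize⟩ := ArithCircuit.exists_computes_size_eq_complexity p
  rw [← hsize, ← size_prune w P]
  refine ArithCircuit.complexity_le_size (isFanInTwo_prune w h2) ?_
  show (prune w P).eval = topComponent w p
  rw [eval_prune, show P.eval = p from hP]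

/-! ### Rank characterisation of arborescences -/

section Arborescence

variable {N : ℕ}

/-- **Arborescences are the parent maps admitting a strictly decreasing rank** along parent
pointers (rank = distance to the root). [folklore] -/
theorem isArborescence_iff_exists_rank (t : Fin N → Option (Fin N)) :
    IsArborescence t ↔ ∃ rk : Fin N → ℕ, ∀ i j, t i = some j → rk j < rk i := by
  classical
  constructor
  · intro ht
    refine ⟨fun i => Nat.find (ht i), fun i j hij => ?_⟩
    have hi := Nat.find_spec (ht i)
    obtain ⟨r, hr⟩ : ∃ r, Nat.find (ht i) = r + 1 := by
      rcases h0 : Nat.find (ht i) with _ | r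
      · rw [h0] at hi
        simp at hi
      · exact ⟨r, rfl⟩
    rw [hr, Function.iterate_succ_apply, parentMap_some, hij] at hi
    calc Nat.find (ht j) ≤ r := Nat.find_le hi
      _ < Nat.find (ht i) := by rw [hr]; exact Nat.lt_succ_self r
  · rintro ⟨rk, hrk⟩
    suffices h : ∀ n, ∀ i : Fin N, rk i < n → ∃ r, (parentMap t)^[r] (some i) = none from
      fun i => h _ i (Nat.lt_succ_self _)
    intro n
    induction n with
    | zero => intro i hi; exact absurd hi (Nat.not_lt_zero _)
    | succ n ih =>
      intro i hi
      cases hti : t i with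
      | none => exact ⟨1, by simp [hti]⟩
      | some j =>
        obtain ⟨r, hr⟩ := ih j (by have := hrk i j hti; omega)
        exact ⟨r + 1, by rw [Function.iterate_succ_apply, parentMap_some, hti, hr]⟩

variable (R : Finset (Fin N)) {M : ℕ} (e : {i : Fin N // i ∉ R} ≃ Fin M)

/-- Shrink a parent map on `Fin N` whose pointers into `R` come only from `R` to a parent map on
`Fin M ≃ {i ∉ R}` (pointers into `R` — absent in the intended use — are sent to the root). [folklore] -/
def shrink (t : Fin N → Option (Fin N)) : Fin M → Option (Fin M) := fun k =>
  match t (e.symm k).1 with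
  | none => none
  | some j => if hj : j ∈ R then none else some (e ⟨j, hj⟩)

/-- Lift a parent map on `Fin M` to `Fin N`: the rows of `R` point to the root. [folklore] -/
def lift (s : Fin M → Option (Fin M)) : Fin N → Option (Fin N) := fun i =>
  if hi : i ∈ R then none else (s (e ⟨i, hi⟩)).map fun k => (e.symm k).1

/-- `shrink` at a row pointing to the root. [folklore] -/
theorem shrink_apply_of_eq_none {t : Fin N → Option (Fin N)} {k : Fin M}
    (h : t (e.symm k).1 = none) : shrink R e t k = none := by
  simp [shrink, h]

/-- `shrink` at a row pointing outside `R`. [folklore] -/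
theorem shrink_apply_of_eq_some {t : Fin N → Option (Fin N)} {k : Fin M} {j : Fin N}
    (h : t (e.symm k).1 = some j) (hj : j ∉ R) : shrink R e t k = some (e ⟨j, hj⟩) := by
  simp [shrink, h, hj]

/-- In a lift, pointers into `R` come only from `R` (in fact there are none). [folklore] -/
theorem lift_pointer (s : Fin M → Option (Fin M)) (i j : Fin N) (h : lift R e s i = some j) :
    j ∉ R ∧ i ∉ R := by
  unfold lift at h
  by_cases hi : i ∈ R
  · simp [hi] at h
  · simp only [hi, dite_false] at h
    cases hs : s (e ⟨i, hi⟩) with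
    | none => rw [hs] at h; simp at h
    | some k =>
      rw [hs, Option.map_some] at h
      have := Option.some_injective _ h
      exact ⟨this ▸ (e.symm k).2, hi⟩

/-- `shrink ∘ lift = id`. [folklore] -/
theorem shrink_lift (s : Fin M → Option (Fin M)) : shrink R e (lift R e s) = s := by
  funext k
  have hk : (e.symm k).1 ∉ R := (e.symm k).2
  have hlift : lift R e s (e.symm k).1 = (s k).map fun k' => (e.symm k').1 := by
    unfold lift
    rw [dif_neg hk]
    simp
  cases hs : s k with
  | none =>
    rw [hs, Option.map_none] at hlift
    exact shrink_apply_of_eq_none R e hlift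
  | some k2 =>
    rw [hs, Option.map_some] at hlift
    rw [shrink_apply_of_eq_some R e hlift (e.symm k2).2]
    simp

/-- Lifts of arborescences are arborescences. [folklore] -/
theorem isArborescence_lift {s : Fin M → Option (Fin M)} (hs : IsArborescence s) :
    IsArborescence (lift R e s) := by
  classical
  rw [isArborescence_iff_exists_rank] at hs ⊢
  obtain ⟨rk, hrk⟩ := hs
  refine ⟨fun i => if hi : i ∈ R then 0 else rk (e ⟨i, hi⟩) + 1, fun i j hij => ?_⟩
  obtain ⟨hj, hi⟩ := lift_pointer R e s i j hij
  unfold lift at hij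
  rw [dif_neg hi] at hij
  cases hsk : s (e ⟨i, hi⟩) with
  | none => rw [hsk] at hij; simp at hij
  | some k =>
    rw [hsk, Option.map_some] at hij
    have hjk : j = (e.symm k).1 := (Option.some_injective _ hij).symm
    have hek : e ⟨j, hj⟩ = k := by
      rw [Equiv.apply_eq_iff_eq_symm_apply]; exact Subtype.ext hjk
    simp only [dif_neg hi, dif_neg hj, hek]
    have := hrk _ _ hsk
    omega

/-- Shrinks of arborescences whose pointers into `R` come only from `R` are arborescences.
[folklore] -/
theorem isArborescence_shrink {t : Fin N → Option (Fin N)} (ht : IsArborescence t)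
    (hP : ∀ i j, t i = some j → j ∈ R → i ∈ R) : IsArborescence (shrink R e t) := by
  classical
  rw [isArborescence_iff_exists_rank] at ht ⊢
  obtain ⟨rk, hrk⟩ := ht
  refine ⟨fun k => rk (e.symm k).1, fun k k2 hk => ?_⟩
  cases htk : t (e.symm k).1 with
  | none => rw [shrink_apply_of_eq_none R e htk] at hk; simp at hk
  | some j =>
    have hj : j ∉ R := fun hj => (e.symm k).2 (hP _ _ htk hj)
    rw [shrink_apply_of_eq_some R e htk hj] at hk
    have hk2 : k2 = e ⟨j, hj⟩ := (Option.some_injective _ hk).symm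
    subst hk2
    simp only [Equiv.symm_apply_apply]
    exact hrk _ _ htk

end Arborescence

/-! ### The projection killing the rows `R` -/

section Projection

variable {N : ℕ} (R : Finset (Fin N)) {M : ℕ} (e : {i : Fin N // i ∉ R} ≃ Fin M)

/-- The substitution: rows in `R` ↦ `1`; a pointer from outside `R` into `R` ↦ `0`; the
remaining variables are renamed to `Fin M × Option (Fin M)`. [folklore] -/
def killRows : Fin N × Option (Fin N) → MvPolynomial (Fin M × Option (Fin M)) ℝ≥0 := fun v =>
  if hi : v.1 ∈ R then 1 else
    match v.2 with
    | none => X (e ⟨v.1, hi⟩, none)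
    | some j => if hj : j ∈ R then 0 else X (e ⟨v.1, hi⟩, some (e ⟨j, hj⟩))

/-- `killRows` is a projection (every value is a variable or a constant). [folklore] -/
theorem isProjection_killRows (p : MvPolynomial (Fin N × Option (Fin N)) ℝ≥0) :
    IsProjection (aeval (killRows R e) p) p := by
  refine ⟨killRows R e, fun v => ?_, rfl⟩
  unfold killRows
  by_cases hi : v.1 ∈ R
  · right; exact ⟨1, by simp [hi]⟩
  · rcases v with ⟨i, _ | j⟩
    · simp only at hi
      left; exact ⟨(e ⟨i, hi⟩, none), by simp [hi]⟩
    · simp only at hi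
      by_cases hj : j ∈ R
      · right; exact ⟨0, by simp [hi, hj]⟩
      · left; exact ⟨(e ⟨i, hi⟩, some (e ⟨j, hj⟩)), by simp [hi, hj]⟩

/-- The value of the monomial of a parent map `t` under `killRows`: zero if some row outside
`R` points into `R`, otherwise the monomial of the shrunk map. [folklore] -/
theorem prod_killRows (t : Fin N → Option (Fin N)) :
    ∏ i : Fin N, killRows R e (i, t i) =
      if (∀ i j, t i = some j → j ∈ R → i ∈ R) then
        ∏ k : Fin M, (X (k, shrink R e t k) : MvPolynomial (Fin M × Option (Fin M)) ℝ≥0)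
      else 0 := by
  classical
  -- split the product over `R` and its complement
  have hsplit : ∏ i : Fin N, killRows R e (i, t i) =
      ∏ x : {i : Fin N // i ∉ R}, killRows R e (x.1, t x.1) := by
    rw [← Fintype.prod_subtype_mul_prod_subtype (fun i : Fin N => i ∈ R)
      (fun i => killRows R e (i, t i))]
    rw [Finset.prod_eq_one (fun x _ => by simp [killRows, x.2]), one_mul]
  rw [hsplit]
  split_ifs with hP
  · refine Fintype.prod_equiv e _ _ fun x => ?_
    have hx : x.1 ∉ R := x.2
    cases htx : t x.1 with
    | none =>
      have h1 : shrink R e t (e x) = none :=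
        shrink_apply_of_eq_none R e (by simpa using htx)
      rw [h1]; simp [killRows, hx]
    | some j =>
      have hj : j ∉ R := fun hj => hx (hP _ _ htx hj)
      have h1 : shrink R e t (e x) = some (e ⟨j, hj⟩) :=
        shrink_apply_of_eq_some R e (by simpa using htx) hj
      rw [h1]; simp [killRows, hx, hj]
  · push Not at hP
    obtain ⟨i, j, hij, hj, hi⟩ := hP
    apply Finset.prod_eq_zero (Finset.mem_univ ⟨i, hi⟩)
    simp [killRows, hi, hij, hj]

/-- `ST_N` under `killRows`: the sum, over arborescences whose pointers into `R` come only from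
`R`, of the monomials of their shrinks. [folklore] -/
theorem aeval_killRows_stPoly :
    aeval (killRows R e) (stPoly ℝ≥0 N) =
      ∑ t ∈ (arborescences N).filter (fun t => ∀ i j, t i = some j → j ∈ R → i ∈ R),
        monomial (arbMonomial (shrink R e t)) (1 : ℝ≥0) := by
  classical
  rw [stPoly_eq_sum_monomial]
  simp only [map_sum]
  rw [Finset.sum_filter]
  refine Finset.sum_congr rfl fun t _ => ?_
  rw [← prod_X_arb_eq_monomial, map_prod]
  simp only [aeval_X]
  rw [prod_killRows, ← prod_X_arb_eq_monomial]

/-- Over `ℝ≥0` the support of a sum of coefficient-one monomials is the image. [folklore] -/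
theorem support_sum_monomial_one {ι τ : Type*} [DecidableEq τ] (S : Finset ι) (m : ι → τ →₀ ℕ) :
    (∑ t ∈ S, monomial (m t) (1 : ℝ≥0) : MvPolynomial τ ℝ≥0).support = S.image m := by
  classical
  ext d
  rw [mem_support_iff, coeff_sum, Finset.mem_image]
  simp only [coeff_monomial]
  rw [Finset.sum_boole]
  constructor
  · intro h
    have : (S.filter fun t => m t = d).Nonempty := by
      by_contra hne
      rw [Finset.not_nonempty_iff_eq_empty] at hne
      exact h (by rw [hne]; simp)
    obtain ⟨t, ht⟩ := this
    exact ⟨t, (Finset.mem_filter.mp ht).1, (Finset.mem_filter.mp ht).2⟩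
  · rintro ⟨t, ht, htd⟩
    have hpos : 0 < (S.filter fun t => m t = d).card :=
      Finset.card_pos.mpr ⟨t, Finset.mem_filter.mpr ⟨ht, htd⟩⟩
    exact_mod_cast hpos.ne'

/-- **The support of `ST_N` under `killRows` is the support of `ST_M`.** [folklore] -/
theorem support_aeval_killRows_stPoly :
    (aeval (killRows R e) (stPoly ℝ≥0 N)).support = (stPoly ℝ≥0 M).support := by
  classical
  rw [aeval_killRows_stPoly, support_sum_monomial_one, support_stPoly]
  ext d
  simp only [Finset.mem_image, Finset.mem_filter, mem_arborescences]
  constructor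
  · rintro ⟨t, ⟨ht, hP⟩, rfl⟩
    exact ⟨shrink R e t, isArborescence_shrink R e ht hP, rfl⟩
  · rintro ⟨s, hs, rfl⟩
    refine ⟨lift R e s, ⟨isArborescence_lift R e hs, fun i j hij hj => ?_⟩, by rw [shrink_lift]⟩
    exact absurd hj (lift_pointer R e s i j hij).1

/-- A polynomial all of whose variables lie in the rows `R` becomes a nonzero constant under
`killRows`. [folklore] -/
theorem aeval_killRows_eq_C {p : MvPolynomial (Fin N × Option (Fin N)) ℝ≥0}
    (hp : ∀ d ∈ p.support, ∀ v ∈ d.support, v.1 ∈ R) :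
    aeval (killRows R e) p = C (∑ d ∈ p.support, coeff d p) := by
  classical
  conv_lhs => rw [p.as_sum]
  rw [map_sum, map_sum]
  refine Finset.sum_congr rfl fun d hd => ?_
  rw [aeval_monomial, ← C_eq_algebraMap]
  suffices h : (d.prod fun v k => killRows R e v ^ k) = 1 by rw [h, mul_one]
  refine Finset.prod_eq_one fun v hv => ?_
  have : killRows R e v = 1 := by simp [killRows, hp d hd v hv]
  show killRows R e v ^ (d v) = 1
  rw [this, one_pow]

/-- Over `ℝ≥0` the sum of the coefficients of a nonzero polynomial is nonzero. [folklore] -/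
theorem sum_coeff_ne_zero {τ : Type*} {p : MvPolynomial τ ℝ≥0} (hp : p ≠ 0) :
    ∑ d ∈ p.support, coeff d p ≠ 0 := by
  obtain ⟨d, hd⟩ := exists_coeff_ne_zero hp
  intro h
  rw [Finset.sum_eq_zero_iff] at h
  exact hd (h d (mem_support_iff.mpr hd))

end Projection

/-! ### Jerrum–Snir for every polynomial with the support of `ST` -/

section SupportBound

/-- **Jerrum–Snir by support.**  Every fan-in-two circuit over `ℝ≥0` computing a polynomial
with the same SUPPORT as `ST_M`, `M ≥ 60`, has at least `2^{M/20}` product gates (the tree's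
argument is support-only). [cite: JerrumSnir1982, §4.5 and §5.1] -/
theorem two_rpow_le_prodCount_of_support_eq {M : ℕ} (hM : 60 ≤ M)
    {p : MvPolynomial (Fin M × Option (Fin M)) ℝ≥0} (hp : p.support = (stPoly ℝ≥0 M).support)
    {P : ArithCircuit ℝ≥0 (Fin M × Option (Fin M))} (hP2 : P.IsFanInTwo)
    (hP : P.Computes p) : (2 : ℝ) ^ ((1 / 20 : ℝ) * M) ≤ prodCount P := by
  classical
  have heval : P.eval = p := hP
  have hhom : p.IsHomogeneous M := by
    intro d hd
    have hd' : d ∈ (stPoly ℝ≥0 M).support := hp ▸ mem_support_iff.mpr hd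
    exact stPoly_isHomogeneous ℝ≥0 M (mem_support_iff.mp hd')
  -- (1) the balanced decomposition with `m = ⌊M/3⌋`
  have hm1 : 1 ≤ M / 3 := by omega
  have hmN : M / 3 < M := by omega
  obtain ⟨L, hLlen, hLsum, hLdeg⟩ :=
    Literature.Barriers.ValiantsHypothesis.exists_decomposition hm1 hmN _ P le_rfl hP2
      (by rw [heval]; exact hhom)
  rw [heval] at hLsum
  -- (2) every product has few monomials
  have hN1 : 1 ≤ M := by omega
  have hNpos : (0 : ℝ) < M := by exact_mod_cast hN1
  set r : ℝ := (9 + 8 * M) / 9 with hr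
  have hrpos : 0 < r := by positivity
  have hterm : ∀ ab ∈ L, ((ab.1 * ab.2).support.card : ℝ) ≤ r ^ M := by
    intro ab hab
    by_cases hb : ab.2 = 0
    · simp only [hb, mul_zero, support_zero, card_empty, Nat.cast_zero]
      positivity
    have hdeg := hLdeg ab hab
    have ha : ab.1 ≠ 0 := by
      intro ha
      rw [ha, totalDegree_zero] at hdeg
      omega
    have hsub : (ab.1 * ab.2).support ⊆ (stPoly ℝ≥0 M).support := by
      obtain ⟨q, hq⟩ := exists_sum_eq_add_of_mem (fun ab : MvPolynomial _ ℝ≥0 × _ => ab.1 * ab.2)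
        L ab hab
      rw [← hp]
      exact support_subset_of_eq_add (hLsum.trans hq)
    obtain ⟨hkN, hcard⟩ := card_support_mul_le hN1 hsub ha hb
    refine hcard.trans (pow_le_pow_left₀ (by positivity) ?_ M)
    have hT := nine_mul_bound_le hdeg.1 hdeg.2
    rw [div_le_iff₀ hNpos, hr]
    have hT' : (9 : ℝ) * ((M + ab.1.totalDegree ^ 2 + (M - ab.1.totalDegree) ^ 2 +
        ab.1.totalDegree * (M - ab.1.totalDegree) : ℕ) : ℝ) ≤ 9 * M + 8 * (M : ℝ) ^ 2 := by
      exact_mod_cast hT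
    nlinarith [hT']
  -- (3) counting monomials
  have hcount : ((M : ℝ) + 1) ^ (M - 1) ≤ prodCount P * r ^ M := by
    have h1 := card_support_sum_le L (r ^ M) hterm
    rw [← hLsum, hp, card_support_stPoly_eq] at h1
    push_cast at h1
    refine h1.trans ?_
    gcongr
  -- (4) arithmetic
  have hq : (28 / 25 : ℝ) ≤ 9 * ((M : ℝ) + 1) / (9 + 8 * M) := ratio_ge (by omega)
  have hqr : 9 * ((M : ℝ) + 1) / (9 + 8 * M) * r = M + 1 := by
    rw [hr]; field_simp
  have hkey : (2 : ℝ) ^ ((1 / 20 : ℝ) * M) * ((M : ℝ) + 1) * r ^ M ≤ ((M : ℝ) + 1) ^ M := by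
    calc (2 : ℝ) ^ ((1 / 20 : ℝ) * M) * ((M : ℝ) + 1) * r ^ M
        ≤ (26 / 25 : ℝ) ^ M * (14 / 13 : ℝ) ^ M * r ^ M := by
          gcongr
          · exact two_rpow_div_twenty_le M
          · exact succ_le_pow_of_sixty_le hM
      _ = (28 / 25 : ℝ) ^ M * r ^ M := by rw [← mul_pow]; norm_num
      _ ≤ (9 * ((M : ℝ) + 1) / (9 + 8 * M)) ^ M * r ^ M := by gcongr
      _ = ((M : ℝ) + 1) ^ M := by rw [← mul_pow, hqr]
  have hpow : ((M : ℝ) + 1) ^ M = ((M : ℝ) + 1) * ((M : ℝ) + 1) ^ (M - 1) := by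
    rw [← pow_succ']; congr 1; omega
  rw [hpow] at hkey
  have hN1' : (0 : ℝ) < (M : ℝ) + 1 := by positivity
  have h5 : (2 : ℝ) ^ ((1 / 20 : ℝ) * M) * r ^ M ≤ ((M : ℝ) + 1) ^ (M - 1) := by
    have := hkey
    rw [mul_comm ((2 : ℝ) ^ _) ((M : ℝ) + 1), mul_assoc] at this
    exact le_of_mul_le_mul_left this hN1'
  have h6 : (2 : ℝ) ^ ((1 / 20 : ℝ) * M) * r ^ M ≤ prodCount P * r ^ M := h5.trans hcount
  exact le_of_mul_le_mul_right h6 (pow_pos hrpos M)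

/-- Hence `2^{M/20} ≤ L_{ℝ≥0}(p)` for every `p` with the support of `ST_M`, `M ≥ 60`.
[cite: JerrumSnir1982, §4.5 and §5.1] -/
theorem two_rpow_le_complexity_of_support_eq {M : ℕ} (hM : 60 ≤ M)
    {p : MvPolynomial (Fin M × Option (Fin M)) ℝ≥0}
    (hp : p.support = (stPoly ℝ≥0 M).support) :
    (2 : ℝ) ^ ((1 / 20 : ℝ) * M) ≤ complexity p := by
  obtain ⟨P, h2, hP, hsize⟩ := ArithCircuit.exists_computes_size_eq_complexity p
  calc (2 : ℝ) ^ ((1 / 20 : ℝ) * M) ≤ prodCount P := two_rpow_le_prodCount_of_support_eq hM hp h2 hP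
    _ ≤ (P.size : ℝ) := by exact_mod_cast prodCount_le_size P
    _ = complexity p := by rw [hsize]

end SupportBound

/-! ### Concentrating the cofactor on few rows: the lexicographic row weight -/

section Rows

variable {N : ℕ}

/-- Base-`B` digit vectors are determined by their value. [folklore] -/
theorem eq_of_sum_mul_pow_eq {B : ℕ} :
    ∀ {n : ℕ} (f g : Fin n → ℕ), (∀ i, f i < B) → (∀ i, g i < B) →
      ∑ i, f i * B ^ (i : ℕ) = ∑ i, g i * B ^ (i : ℕ) → f = g := by
  intro n
  induction n with
  | zero => intro f g _ _ _; funext i; exact i.elim0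
  | succ n ih =>
    intro f g hf hg h
    rw [Fin.sum_univ_succ, Fin.sum_univ_succ] at h
    simp only [Fin.val_zero, pow_zero, mul_one, Fin.val_succ, pow_succ] at h
    have hB : 0 < B := lt_of_le_of_lt (Nat.zero_le _) (hf 0)
    have hre : ∀ u : Fin (n + 1) → ℕ, ∑ i : Fin n, u i.succ * (B ^ (i : ℕ) * B) =
        B * ∑ i : Fin n, u i.succ * B ^ (i : ℕ) := by
      intro u; rw [Finset.mul_sum]; refine Finset.sum_congr rfl fun i _ => ?_; ring
    rw [hre f, hre g] at h
    have h0 : f 0 = g 0 := by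
      have := congrArg (· % B) h
      simpa [Nat.add_mul_mod_self_left, Nat.mod_eq_of_lt (hf 0), Nat.mod_eq_of_lt (hg 0)] using this
    rw [h0] at h
    have h1 : ∑ i : Fin n, f i.succ * B ^ (i : ℕ) = ∑ i : Fin n, g i.succ * B ^ (i : ℕ) :=
      Nat.eq_of_mul_eq_mul_left hB (by omega)
    have h2 := ih (fun i => f i.succ) (fun i => g i.succ) (fun i => hf _) (fun i => hg _) h1
    funext i
    refine Fin.cases h0 (fun i => ?_) i
    exact congrFun h2 i

/-- The lexicographic row weight in base `B`: variable `x_{i,j}` weighs `B^i`. [folklore] -/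
def rowWeight (B : ℕ) : Fin N × Option (Fin N) → ℕ := fun v => B ^ (v.1 : ℕ)

/-- The row degree of a monomial in row `i`. [folklore] -/
def rowDeg (d : (Fin N × Option (Fin N)) →₀ ℕ) (i : Fin N) : ℕ :=
  ∑ v ∈ d.support with v.1 = i, d v

/-- The row weight of a monomial is its base-`B` number with digits the row degrees. [folklore] -/
theorem weight_rowWeight (B : ℕ) (d : (Fin N × Option (Fin N)) →₀ ℕ) :
    Finsupp.weight (rowWeight B) d = ∑ i : Fin N, rowDeg d i * B ^ (i : ℕ) := by
  classical
  rw [Finsupp.weight_apply, Finsupp.sum]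
  simp only [rowWeight, smul_eq_mul, rowDeg, Finset.sum_mul]
  rw [← Finset.sum_fiberwise d.support Prod.fst (fun v => d v * B ^ (v.1 : ℕ))]
  refine Finset.sum_congr rfl fun i _ => Finset.sum_congr rfl fun v hv => ?_
  rw [(Finset.mem_filter.mp hv).2]

/-- Row degrees are bounded by the degree. [folklore] -/
theorem rowDeg_le_degree (d : (Fin N × Option (Fin N)) →₀ ℕ) (i : Fin N) :
    rowDeg d i ≤ d.sum fun _ k => k := by
  classical
  rw [Finsupp.sum]
  exact Finset.sum_le_sum_of_subset_of_nonneg (Finset.filter_subset _ _) fun _ _ _ => Nat.zero_le _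

/-- A variable occurring in `d` makes its row degree positive. [folklore] -/
theorem rowDeg_pos_of_mem {d : (Fin N × Option (Fin N)) →₀ ℕ} {v : Fin N × Option (Fin N)}
    (hv : v ∈ d.support) : 0 < rowDeg d v.1 := by
  classical
  unfold rowDeg
  have hmem : v ∈ d.support.filter (fun u => u.1 = v.1) := Finset.mem_filter.mpr ⟨hv, rfl⟩
  exact lt_of_lt_of_le (Nat.pos_of_ne_zero (Finsupp.mem_support_iff.mp hv))
    (Finset.single_le_sum (f := fun u => d u) (fun _ _ => Nat.zero_le _) hmem)

/-- The rows of positive row degree are at most `deg d` many. [folklore] -/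
theorem card_filter_rowDeg_pos_le (d : (Fin N × Option (Fin N)) →₀ ℕ) :
    (Finset.univ.filter fun i : Fin N => 0 < rowDeg d i).card ≤ d.sum fun _ k => k := by
  classical
  calc (Finset.univ.filter fun i : Fin N => 0 < rowDeg d i).card
      = ∑ i ∈ Finset.univ.filter (fun i : Fin N => 0 < rowDeg d i), 1 := by simp
    _ ≤ ∑ i ∈ Finset.univ.filter (fun i : Fin N => 0 < rowDeg d i), rowDeg d i :=
        Finset.sum_le_sum fun i hi => (Finset.mem_filter.mp hi).2
    _ ≤ ∑ i : Fin N, rowDeg d i :=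
        Finset.sum_le_sum_of_subset_of_nonneg (Finset.filter_subset _ _) fun _ _ _ => Nat.zero_le _
    _ = d.sum fun _ k => k := by
        rw [Finsupp.sum]
        simp only [rowDeg]
        rw [← Finset.sum_fiberwise d.support Prod.fst (fun v => d v)]

/-- **The top row-lexicographic component of a nonzero `h` lives on at most `deg h` rows**: with
`B = deg h + 1`, all monomials of `top_{rowWeight B} h` have the same row-degree vector, whose
support `R` has at most `deg h` rows, and every variable of every such monomial lies in a row
of `R`. [folklore] -/
theorem exists_rows_topComponent {h : MvPolynomial (Fin N × Option (Fin N)) ℝ≥0} (hh : h ≠ 0) :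
    ∃ R : Finset (Fin N), R.card ≤ h.totalDegree ∧
      ∀ d ∈ (topComponent (rowWeight (h.totalDegree + 1)) h).support, ∀ v ∈ d.support, v.1 ∈ R := by
  classical
  set B := h.totalDegree + 1 with hB
  set hs := topComponent (rowWeight B) h with hhs
  have hne : hs ≠ 0 := topComponent_ne_zero _ hh
  obtain ⟨d₀, hd₀⟩ := exists_coeff_ne_zero hne
  have hd₀s : d₀ ∈ hs.support := mem_support_iff.mpr hd₀
  refine ⟨Finset.univ.filter fun i => 0 < rowDeg d₀ i, ?_, ?_⟩
  · refine (card_filter_rowDeg_pos_le d₀).trans ?_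
    exact le_totalDegree (support_topComponent_subset _ h hd₀s)
  · intro d hd v hv
    -- `d` and `d₀` have the same row weight, hence the same row degrees
    have hwd : Finsupp.weight (rowWeight B) d = weightedTotalDegree (rowWeight B) h := by
      have := mem_support_iff.mp hd
      rw [hhs, coeff_topComponent] at this
      by_contra hne'
      exact this (if_neg hne')
    have hwd₀ : Finsupp.weight (rowWeight B) d₀ = weightedTotalDegree (rowWeight B) h := by
      have := mem_support_iff.mp hd₀s
      rw [hhs, coeff_topComponent] at this
      by_contra hne'
      exact this (if_neg hne')
    have hlt : ∀ d' ∈ hs.support, ∀ i, rowDeg d' i < B := by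
      intro d' hd' i
      have := le_totalDegree (support_topComponent_subset _ h hd')
      have := rowDeg_le_degree d' i
      omega
    have heq : rowDeg d = rowDeg d₀ :=
      eq_of_sum_mul_pow_eq (rowDeg d) (rowDeg d₀) (hlt d hd) (hlt d₀ hd₀s)
        (by rw [← weight_rowWeight, ← weight_rowWeight, hwd, hwd₀])
    rw [Finset.mem_filter]
    refine ⟨Finset.mem_univ _, ?_⟩
    rw [← heq]
    exact rowDeg_pos_of_mem hv

/-- `ST_N` is row-lexicographically homogeneous (every monomial has row degrees all `1`).
[folklore] -/
theorem isWeightedHomogeneous_stPoly (B : ℕ) :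
    IsWeightedHomogeneous (rowWeight B) (stPoly ℝ≥0 N) (∑ i : Fin N, B ^ (i : ℕ)) := by
  classical
  rw [stPoly_eq_sum_monomial]
  refine IsWeightedHomogeneous.sum _ _ _ fun t _ => ?_
  refine isWeightedHomogeneous_monomial _ _ _ ?_
  rw [arbMonomial, map_sum]
  refine Finset.sum_congr rfl fun i _ => ?_
  simp [Finsupp.weight_apply, rowWeight]

end Rows

/-! ### The theorem: a cofactor of degree `δ` buys at most `δ` rows of `ST` -/

section Main

variable {N : ℕ}

/-- **Low-degree cofactors do not help the spanning-tree polynomial.**  For every nonzero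
`h ∈ ℝ≥0[x]` with `deg h + 60 ≤ N`:  `2^{(N - deg h)/20} ≤ L_{ℝ≥0}(ST_N · h) + 1`.
Proof: pass to the top row-lexicographic component (free, `complexity_topComponent_le`;
`ST_N` is row-homogeneous so `top(ST·h) = ST · top h`), which concentrates the cofactor on a set
`R` of at most `deg h` rows; the projection `killRows` (rows of `R ↦ 1`, pointers into `R ↦ 0`,
rename) turns `top h` into a nonzero constant and `ST_N` into a polynomial with the support of
`ST_{N-|R|}`, to which Jerrum–Snir's (support-only) bound applies. [folklore] -/
theorem two_rpow_le_complexity_stPoly_mul {h : MvPolynomial (Fin N × Option (Fin N)) ℝ≥0}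
    (hh : h ≠ 0) (hN : h.totalDegree + 60 ≤ N) :
    (2 : ℝ) ^ ((1 / 20 : ℝ) * (N - h.totalDegree : ℕ)) ≤
      complexity (stPoly ℝ≥0 N * h) + 1 := by
  classical
  set δ := h.totalDegree with hδ
  set W := rowWeight (N := N) (δ + 1) with hW
  obtain ⟨R, hRcard, hrows⟩ := exists_rows_topComponent hh
  set hs := topComponent W h with hhs
  have hne : hs ≠ 0 := topComponent_ne_zero _ hh
  -- the complement of `R` and its size
  set M := Fintype.card {i : Fin N // i ∉ R} with hM
  have hMeq : M = N - R.card := by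
    rw [hM, Fintype.card_subtype_compl, Fintype.card_fin, Fintype.card_coe]
  have hM60 : 60 ≤ M := by omega
  let e : {i : Fin N // i ∉ R} ≃ Fin M := Fintype.equivFin _
  -- (1) initial form: `L(ST · hs) ≤ L(ST · h)`
  have h1 : complexity (stPoly ℝ≥0 N * hs) ≤ complexity (stPoly ℝ≥0 N * h) := by
    have := complexity_topComponent_le W (stPoly ℝ≥0 N * h)
    rwa [topComponent_mul, topComponent_eq_self_of_isWeightedHomogeneous W
      (isWeightedHomogeneous_stPoly (δ + 1))] at this
  -- (2) projection: `L(aeval φ (ST · hs)) ≤ L(ST · hs)` and `aeval φ (ST · hs) = q * C η`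
  set q := aeval (killRows R e) (stPoly ℝ≥0 N) with hq
  set η : ℝ≥0 := ∑ d ∈ hs.support, coeff d hs with hη
  have hη0 : η ≠ 0 := sum_coeff_ne_zero hne
  have h2 : complexity (q * C η) ≤ complexity (stPoly ℝ≥0 N * hs) := by
    have := complexity_le_of_isProjection (isProjection_killRows R e (stPoly ℝ≥0 N * hs))
    rwa [map_mul, aeval_killRows_eq_C R e hrows] at this
  -- (3) unscale: `L(q) ≤ L(q * C η) + 1`
  have h3 : complexity q ≤ complexity (q * C η) + 1 := by
    have hqq : q = η⁻¹ • (q * C η) := by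
      rw [mul_comm, smul_eq_C_mul, ← mul_assoc, ← C_mul, inv_mul_cancel₀ hη0, C_1, one_mul]
    conv_lhs => rw [hqq]
    exact complexity_smul_le_holds _ _
  -- (4) Jerrum–Snir by support on `Fin M`
  have h4 : (2 : ℝ) ^ ((1 / 20 : ℝ) * M) ≤ complexity q :=
    two_rpow_le_complexity_of_support_eq hM60 (support_aeval_killRows_stPoly R e)
  -- combine
  have hmono : (2 : ℝ) ^ ((1 / 20 : ℝ) * (N - δ : ℕ)) ≤ (2 : ℝ) ^ ((1 / 20 : ℝ) * M) := by
    apply Real.rpow_le_rpow_of_exponent_le (by norm_num)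
    have : ((N - δ : ℕ) : ℝ) ≤ M := by exact_mod_cast (show N - δ ≤ M by omega)
    linarith
  calc (2 : ℝ) ^ ((1 / 20 : ℝ) * (N - δ : ℕ)) ≤ complexity q := hmono.trans h4
    _ ≤ (complexity (q * C η) : ℝ) + 1 := by exact_mod_cast h3
    _ ≤ (complexity (stPoly ℝ≥0 N * h) : ℝ) + 1 := by
        have h21 : (complexity (q * C η) : ℝ) ≤ complexity (stPoly ℝ≥0 N * h) := by
          exact_mod_cast h2.trans h1
        linarith

/-- Growth: for every `c` there is `N ≥ 120` with `40 ((log₂ N + c)^c + 1) < N`. [folklore] -/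
theorem exists_qp_lt_forty (c : ℕ) : ∃ N : ℕ, 120 ≤ N ∧ 40 * ((Nat.log 2 N + c) ^ c + 1) < N := by
  have ht := tendsto_pow_const_div_const_pow_of_one_lt (c + 1) (one_lt_two (α := ℝ))
  have hev : ∀ᶠ m : ℕ in Filter.atTop, (m : ℝ) ^ (c + 1) / 2 ^ m ≤ 1 :=
    ht.eventually (ge_mem_nhds one_pos)
  obtain ⟨N₀, hN₀⟩ := Filter.eventually_atTop.1 hev
  set L : ℕ := max (max N₀ (80 * 2 ^ c + 1)) (max c 7) with hLdef
  have hL0 : N₀ ≤ L := le_trans (le_max_left _ _) (le_max_left _ _)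
  have hL1 : 80 * 2 ^ c + 1 ≤ L := le_trans (le_max_right _ _) (le_max_left _ _)
  have hLc : c ≤ L := le_trans (le_max_left _ _) (le_max_right _ _)
  have hL7 : 7 ≤ L := le_trans (le_max_right _ _) (le_max_right _ _)
  refine ⟨2 ^ L, ?_, ?_⟩
  · calc 120 ≤ 2 ^ 7 := by norm_num
      _ ≤ 2 ^ L := Nat.pow_le_pow_right two_pos hL7
  rw [Nat.log_pow one_lt_two]
  have h1 : (L : ℝ) ^ (c + 1) / 2 ^ L ≤ 1 := hN₀ L hL0
  rw [div_le_one (by positivity)] at h1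
  have h2 : L ^ (c + 1) ≤ 2 ^ L := by exact_mod_cast h1
  have hpos : 1 ≤ L ^ c := Nat.one_le_pow _ _ (by omega)
  have hpow2 : 1 ≤ 2 ^ c := Nat.one_le_two_pow
  calc 40 * ((L + c) ^ c + 1) ≤ 40 * ((2 * L) ^ c + L ^ c) := by
        apply Nat.mul_le_mul_left
        exact add_le_add (Nat.pow_le_pow_left (by omega) c) hpos
    _ = (40 * 2 ^ c + 40) * L ^ c := by rw [mul_pow]; ring
    _ < (80 * 2 ^ c + 1) * L ^ c := Nat.mul_lt_mul_of_pos_right (by omega) (by omega)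
    _ ≤ L * L ^ c := Nat.mul_le_mul_right _ hL1
    _ = L ^ (c + 1) := by ring
    _ ≤ 2 ^ L := h2

open Summit.ValiantsHypothesis.ValiantsHypothesis.Theses.DivisionGap (ZeroOneTransfer)

/-- **`ZeroOneTransfer` with LOW-DEGREE cofactors is false.**  The natural strengthening of the
crux asking in addition that the cofactor have degree at most half the degree of `f_n` fails:
for `f = ST` (0/1 coefficients, `VP_ℂ`) a cofactor of degree `≤ deg(ST_N)/2 ≤ N/2` still leaves
`L(ST_N · h) + 1 ≥ 2^{N/40}` by `two_rpow_le_complexity_stPoly_mul`.  So every positivity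
normal form `f·h = g` behind a proof of the crux must use cofactors of degree comparable to
`deg f` (for `ST`: `> N - O((log N)^c)`). [folklore] -/
theorem zeroOneTransfer_lowDegreeCofactor_false :
    ¬ (∀ (σ : ℕ → Type) [∀ n, Fintype (σ n)] (f : ∀ n, MvPolynomial (σ n) ℝ≥0),
        (∀ n m, MvPolynomial.coeff m (f n) = 0 ∨ MvPolynomial.coeff m (f n) = 1) →
        Literature.Computability.AlgebraicComplexity.IsVPFamily (k := ℂ)
          (fun n => MvPolynomial.map (Complex.ofRealHom.comp NNReal.toRealHom) (f n)) →
        ∃ c : ℕ, ∀ n, ∃ h : MvPolynomial (σ n) ℝ≥0, h ≠ 0 ∧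
          h.totalDegree ≤ (f n).totalDegree / 2 ∧
          Literature.Computability.AlgebraicComplexity.complexity (f n * h) +
            Literature.Computability.AlgebraicComplexity.complexity h ≤
              2 ^ ((Nat.log 2 n + c) ^ c)) := by
  intro H
  have hmap : (fun N => map (Complex.ofRealHom.comp NNReal.toRealHom) (stPoly ℝ≥0 N)) =
      fun N => stPoly ℂ N := by
    funext N; exact map_stPoly _ N
  have hVP : IsVPFamily (k := ℂ)
      (fun N => map (Complex.ofRealHom.comp NNReal.toRealHom) (stPoly ℝ≥0 N)) := by
    rw [hmap]; exact isVPFamily_stPoly_holds ℂ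
  have h01 : ∀ (N : ℕ) (m : (Fin N × Option (Fin N)) →₀ ℕ),
      coeff m (stPoly ℝ≥0 N) = 0 ∨ coeff m (stPoly ℝ≥0 N) = 1 := by
    intro N m
    rw [coeff_stPoly]
    split_ifs <;> simp
  obtain ⟨c, hc⟩ := H (fun N => Fin N × Option (Fin N)) (fun N => stPoly ℝ≥0 N) h01 hVP
  obtain ⟨N, hN, hle⟩ := exists_qp_lt_forty c
  obtain ⟨h, hne, hdeg, hbound⟩ := hc N
  have hdegN : h.totalDegree ≤ N / 2 :=
    hdeg.trans (Nat.div_le_div_right (totalDegree_stPoly_le ℝ≥0 N))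
  have hlow := two_rpow_le_complexity_stPoly_mul hne (by omega)
  generalize hE : (Nat.log 2 N + c) ^ c = E at hle hbound
  -- `L(ST·h) ≤ 2^E`, so `2^{(N - deg h)/20} ≤ 2^E + 1 ≤ 2^(E+1)`
  have hup : (complexity (stPoly ℝ≥0 N * h) : ℝ) + 1 ≤ (2 : ℝ) ^ ((E + 1 : ℕ) : ℝ) := by
    rw [Real.rpow_natCast]
    have : complexity (stPoly ℝ≥0 N * h) + 1 ≤ 2 ^ (E + 1) := by
      have := (Nat.le_add_right _ _).trans hbound
      have h1E : 1 ≤ 2 ^ E := Nat.one_le_two_pow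
      rw [pow_succ]; omega
    exact_mod_cast this
  have h1 : (1 / 20 : ℝ) * (N - h.totalDegree : ℕ) ≤ ((E + 1 : ℕ) : ℝ) :=
    (Real.rpow_le_rpow_left_iff one_lt_two).mp (hlow.trans hup)
  have h2 : ((N - h.totalDegree : ℕ) : ℝ) ≤ 20 * ((E + 1 : ℕ) : ℝ) := by linarith
  have h3 : N - h.totalDegree ≤ 20 * (E + 1) := by exact_mod_cast h2
  omega

end Main

end

end Summit.ValiantsHypothesis.ValiantsHypothesis.Theorems.ZeroOneTransfer.Negative
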